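import Summits.NavierStokesRegularity.NavierStokesRegularity.Theorems.HodographBetchovFastClassSqueezeStreamStrainSlice
import Summits.NavierStokesRegularity.NavierStokesRegularity.Theorems.HodographBetchovFastClassSqueezeStreamStrainSlab
import Summits.NavierStokesRegularity.NavierStokesRegularity.Theorems.HodographBetchovClassBudgetsRegulariseStubEnstrophyContinuation
import Literature.Analysis.FluidPDE.LeiZhang2017SmallSwirlContinuation
import Literature.Analysis.FluidPDE.ClassicalSobolevUniqueness
import Literature.Analysis.FluidPDE.TaoLocalisationHolds

/-!
# Crux `HodographBetchov.FastClassSqueeze` — regularity from a STREAM-DIRECTIONAL STRAIN squeeze on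
# the fast class (no slow-class hypothesis)

Helper file for the crux item stmt-NavierStokesRegularity-15832 (`FastClassSqueeze`, route
`HodographBetchov` of `NavierStokesRegularity`). The route proves Clay (A) from TWO class budgets at
one speed level (`ClassBudgetsRegularise`): the SLOW-class production bound (crux
`SlowClassProduction`) and the FAST-class middle-strain squeeze (crux `FastClassSqueeze`). This file
shows that the slow-class budget is dispensable once the fast-class majorant controls the
stream-directional strain `S û` (`û = u/|u|`; `|λ₂(S)| ≤ ‖S û‖ ≤ ‖∇u‖`, so the hypothesis sits between
`FastClassSqueeze` and the `birth` line's fast-gradient squeeze):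

* `hasSmoothExtensionPast_of_streamStrainSqueeze` — for a classical Leray–Hopf solution from a
  rapidly decaying datum on `[0, T)`, a level `l > 0`, `r > 3/2` and `m ≥ 0` with
  `‖S(t,x) u(t,x)‖ ≤ m(t,x) ‖u(t,x)‖` on the fast class `{l < ‖u‖}` and
  `∫₀ᵀ (∫_{l<‖u(t)‖} m^r)^{2/(2r−3)} dt < ∞`, the solution extends smoothly past `T`.
  Proof: the velocity-truncated enstrophy ledger (`truncatedLedger_slice`, with the cut-off
  `exists_speed_cutoff` of the squared speed) at every interior time of every Tao-class solution
  from `u 0` on closed sub-slabs (`slab_ledger`), the slow-class-free Grönwall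
  `enstrophy_gronwall_of_ledger` (bound uniform in the slab), the continuation method
  (`exists_isTaoSolutionOn_of_enstrophy_apriori`, Majda–Bertozzi uniqueness) and the `H¹`
  continuation `ClassBudgetsRegularise.Birth.stub_enstrophyContinuation`.

References: E. Miller, Arch. Ration. Mech. Anal. 235 (2020); H. Beirão da Veiga, Chinese Ann.
Math. Ser. B 16 (1995); T. Tao, Anal. PDE 6 (2013), Cor. 11.1; A. Majda, A. Bertozzi (2002), §3.
-/

noncomputable section

open MeasureTheory Set Function Filter Topology InnerProductSpace
open scoped ENNReal NNReal ContDiff RealInnerProductSpace Laplacian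

-- the summit and its single sub-problem share the name (CONVENTIONS §1), as in every Theorems file
set_option linter.dupNamespace false

namespace Summit.NavierStokesRegularity.NavierStokesRegularity.Theorems.FastClassSqueeze.StreamStrain

open Literature.Analysis Literature.Analysis.FluidPDE
open Summit.NavierStokesRegularity.NavierStokesRegularity.Theorems.ClassBudgetsRegularise

/-- **A smooth cut-off of the squared speed at level `l`.** There are `χ ∈ C^∞(ℝ)` and `D ≥ 0`
with `0 ≤ χ ≤ 1`, `χ = 1` and `χ' = 0` on `|s| ≤ l²`, `χ = 0` on `|s| ≥ 4l²`, `|χ'(s)| |s| ≤ D`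
(`χ = cutoff (2l²)` of `WholeSpaceIBP`, the tree's canonical bump; it is locally constant off the
shell `2l² < |s| < 4l²`, where `|χ'| ≤ C/(2l²)`). [folklore] -/
theorem exists_speed_cutoff {l : ℝ} (hl : 0 < l) :
    ∃ χ : ℝ → ℝ, ∃ D : ℝ, 0 ≤ D ∧ ContDiff ℝ ∞ χ ∧ (∀ s, 0 ≤ χ s ∧ χ s ≤ 1) ∧
      (∀ s, |s| ≤ l ^ 2 → χ s = 1) ∧ (∀ s, |s| ≤ l ^ 2 → deriv χ s = 0) ∧
      (∀ s, 4 * l ^ 2 ≤ |s| → χ s = 0) ∧ (∀ s, |deriv χ s| * |s| ≤ D) := by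
  set R : ℝ := 2 * l ^ 2 with hR
  have hl2 : 0 < l ^ 2 := by positivity
  have hR0 : 0 < R := by positivity
  obtain ⟨C, hC0, hC⟩ := exists_norm_fderiv_cutoff_le (E := ℝ)
  set χ : ℝ → ℝ := cutoff (E := ℝ) R with hχdef
  have hχ : ContDiff ℝ ∞ χ := contDiff_cutoff R
  have hderiv_le : ∀ s : ℝ, |deriv χ s| ≤ C / R := by
    intro s
    have h := hC R hR0 s
    rw [← Real.norm_eq_abs, norm_deriv_eq_norm_fderiv]
    exact h
  -- `χ` is locally constant off the shell, hence `χ' = 0` there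
  have hd1 : ∀ s : ℝ, |s| < R → deriv χ s = 0 := by
    intro s hs
    have hev : χ =ᶠ[𝓝 s] fun _ => (1 : ℝ) := by
      have hopen : IsOpen {t : ℝ | ‖t‖ < R} := isOpen_lt continuous_norm continuous_const
      filter_upwards [hopen.mem_nhds (by simpa [Real.norm_eq_abs] using hs)] with t ht
      exact cutoff_eq_one hR0 (le_of_lt ht)
    rw [hev.deriv_eq, deriv_const]
  have hd0 : ∀ s : ℝ, 2 * R < |s| → deriv χ s = 0 := by
    intro s hs
    have hev : χ =ᶠ[𝓝 s] fun _ => (0 : ℝ) := by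
      have hopen : IsOpen {t : ℝ | 2 * R < ‖t‖} := isOpen_lt continuous_const continuous_norm
      filter_upwards [hopen.mem_nhds (by simpa [Real.norm_eq_abs] using hs)] with t ht
      exact cutoff_eq_zero hR0 (le_of_lt ht)
    rw [hev.deriv_eq, deriv_const]
  refine ⟨χ, 2 * C, by positivity, hχ, fun s => ⟨cutoff_nonneg R s, cutoff_le_one R s⟩, ?_, ?_, ?_, ?_⟩
  · intro s hs
    exact cutoff_eq_one hR0 (by rw [Real.norm_eq_abs, hR]; linarith)
  · intro s hs
    exact hd1 s (by rw [hR]; linarith)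
  · intro s hs
    exact cutoff_eq_zero hR0 (by rw [Real.norm_eq_abs, hR]; linarith)
  · intro s
    by_cases hs : |s| ≤ 2 * R
    · calc |deriv χ s| * |s| ≤ C / R * (2 * R) :=
            mul_le_mul (hderiv_le s) hs (abs_nonneg _) (by positivity)
        _ = 2 * C := by field_simp
    · rw [not_le] at hs
      rw [hd0 s hs, abs_zero, zero_mul]
      positivity

/-- **A smooth cut-off of the squared speed, registered helper-stub form** (`∀`-closed statement of
`exists_speed_cutoff`). [folklore] -/
theorem speed_cutoff_exists : ∀ (l : ℝ), 0 < l →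
    ∃ χ : ℝ → ℝ, ∃ D : ℝ, 0 ≤ D ∧ ContDiff ℝ (⊤ : ℕ∞) χ ∧ (∀ s, 0 ≤ χ s ∧ χ s ≤ 1) ∧
      (∀ s, |s| ≤ l ^ 2 → χ s = 1) ∧ (∀ s, |s| ≤ l ^ 2 → deriv χ s = 0) ∧
      (∀ s, 4 * l ^ 2 ≤ |s| → χ s = 0) ∧ (∀ s, |deriv χ s| * |s| ≤ D) :=
  fun _ hl => exists_speed_cutoff hl

/-- **The velocity-truncated ledger along a classical solution on a closed slab in Tao's class**,
in the form the slow-class-free Grönwall `enstrophy_gronwall_of_ledger` consumes: at every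
interior time `t` with finite fast-class charge `A(t) = (∫_{l<‖u(t)‖} m(t)^r)^{2/(2r−3)}`,
`∫ Σᵢ ⟪∂ᵢu(t), ∂ᵢ∂ₜu(t)⟫ ≤ (C_l + κ A(t)) ∫|∇u(t)|²_F`, `C_l = 108(‖curl‖²+1)‖curl‖² l²/ν`,
`κ = θ(2(1−θ))^{(1−θ)/θ} ν^{−(1−θ)/θ} (2(D‖curl‖²+1) K_S^{2(1−θ)})^{1/θ}`, `θ = 1 − 3/(2r)`
(`truncatedLedger_slice` with the Sobolev data of the slab). [cite: Miller2019, Thm 1.1 (proof of Thm 5.2)] -/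
theorem slab_ledger {ν T : ℝ} (hν : 0 < ν) (hT : 0 < T)
    {u : ℝ → EuclideanSpace ℝ (Fin 3) → EuclideanSpace ℝ (Fin 3)}
    {p : ℝ → EuclideanSpace ℝ (Fin 3) → ℝ} (hsol : FluidPDE.IsClassicalNSSolutionOn (Icc 0 T) ν 0 u p)
    (hu : HasBoundedSobolevNormsOn (Icc 0 T) u)
    (hut : HasBoundedSobolevNormsOn (Icc 0 T) (FluidPDE.timeDerivWithin (Icc 0 T) u))
    (hp : ∀ n : ℕ, ∃ C : ℝ≥0, ∀ t ∈ Icc 0 T, ∫⁻ x, ‖iteratedFDeriv ℝ n (p t) x‖ₑ ^ 2 ≤ C)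
    {l : ℝ} (hl : 0 < l)
    {χ : ℝ → ℝ} (hχ : ContDiff ℝ ∞ χ) (hχ01 : ∀ s, 0 ≤ χ s ∧ χ s ≤ 1)
    (hχ1 : ∀ s, |s| ≤ l ^ 2 → χ s = 1) (hχd0 : ∀ s, |s| ≤ l ^ 2 → deriv χ s = 0)
    (hχ0 : ∀ s, 4 * l ^ 2 ≤ |s| → χ s = 0) {D : ℝ} (hD0 : 0 ≤ D)
    (hχD : ∀ s, |deriv χ s| * |s| ≤ D)
    {r : ℝ} (hr : 3 / 2 < r) {m : ℝ → EuclideanSpace ℝ (Fin 3) → ℝ} (hm0 : ∀ t x, 0 ≤ m t x)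
    (hdir : ∀ t ∈ Ioo 0 T, ∀ x, l < ‖u t x‖ →
      ‖((1 / 2 : ℝ) • (fderiv ℝ (u t) x + ContinuousLinearMap.adjoint (fderiv ℝ (u t) x))) (u t x)‖ ≤
        m t x * ‖u t x‖) :
    ∀ t ∈ Ioo 0 T, (∫⁻ x in {x | l < ‖u t x‖}, ENNReal.ofReal (m t x) ^ r) ^ (2 / (2 * r - 3)) ≠ ⊤ →
      ∫ x, ∑ i, ⟪fderiv ℝ (u t) x (EuclideanSpace.basisFun (Fin 3) ℝ i),
          fderiv ℝ (FluidPDE.timeDerivWithin (Icc 0 T) u t) x (EuclideanSpace.basisFun (Fin 3) ℝ i)⟫ ≤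
        (108 * (‖curlCLM‖ ^ 2 + 1) * ‖curlCLM‖ ^ 2 * l ^ 2 / ν +
          (1 - 3 / (2 * r)) * (2 * (1 - (1 - 3 / (2 * r)))) ^ ((1 - (1 - 3 / (2 * r))) / (1 - 3 / (2 * r))) *
            ν ^ (-((1 - (1 - 3 / (2 * r))) / (1 - 3 / (2 * r)))) *
            (2 * (D * ‖curlCLM‖ ^ 2 + 1) *
              ((SNormLESNormFDerivOfEqConst (EuclideanSpace ℝ (Fin 3))
                (volume : Measure (EuclideanSpace ℝ (Fin 3))) 2 : ℝ) ^ (2 * (1 - (1 - 3 / (2 * r)))))) ^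
              (1 / (1 - 3 / (2 * r))) *
          ((∫⁻ x in {x | l < ‖u t x‖}, ENNReal.ofReal (m t x) ^ r) ^ (2 / (2 * r - 3))).toReal) *
        ∫ x, frobeniusNormSq (fderiv ℝ (u t) x) := by
  have hr0 : 0 < r := by linarith
  have hθ0 : 0 < 1 - 3 / (2 * r) := by
    rw [sub_pos, div_lt_one (by positivity)]; linarith
  have hexp : 1 / r * (1 / (1 - 3 / (2 * r))) = 2 / (2 * r - 3) := by
    field_simp
  have hU : UniqueDiffOn ℝ (Icc 0 T) := uniqueDiffOn_Icc hT
  set W : ℝ → EuclideanSpace ℝ (Fin 3) → EuclideanSpace ℝ (Fin 3) :=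
    FluidPDE.timeDerivWithin (Icc 0 T) u with hW
  have hWsm : FluidPDE.IsSmoothSpaceTimeOn (Icc 0 T) W := hsol.smooth_velocity.timeDerivWithin hU
  -- the Sobolev data of the slab
  obtain ⟨B₀, hB₀⟩ := linfty_bound_of_hasBoundedSobolevNormsOn_holds
    (fun t ht => (hsol.contDiff_velocity ht).of_le (by norm_cast)) hu
  obtain ⟨K₀, -, hK₀⟩ := exists_forall_norm_fderiv_le_of_hasBoundedSobolevNormsOn
    (fun t ht => (hsol.contDiff_velocity ht).of_le (by norm_cast)) hu
  obtain ⟨C₁, hC₁⟩ := hu 1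
  obtain ⟨D₂, hD₂⟩ := hu 2
  obtain ⟨D₃, hD₃⟩ := hu 3
  obtain ⟨E₀, hE₀⟩ := hut 0
  obtain ⟨E₁, hE₁⟩ := hut 1
  obtain ⟨P₀, hP₀⟩ := hp 0
  obtain ⟨P₁, hP₁⟩ := hp 1
  have hzero : ∀ {f : EuclideanSpace ℝ (Fin 3) → EuclideanSpace ℝ (Fin 3)} {C' : ℝ≥0},
      (∫⁻ x, ‖iteratedFDeriv ℝ 0 f x‖ₑ ^ 2 ≤ C') → ∫⁻ x, ‖f x‖ₑ ^ 2 < ⊤ := by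
    intro f C' h
    refine lt_of_le_of_lt ((le_of_eq (lintegral_congr fun x => ?_)).trans h) ENNReal.coe_lt_top
    rw [← ofReal_norm, ← ofReal_norm, norm_iteratedFDeriv_zero]
  have hzero' : ∀ {f : EuclideanSpace ℝ (Fin 3) → ℝ} {C' : ℝ≥0},
      (∫⁻ x, ‖iteratedFDeriv ℝ 0 f x‖ₑ ^ 2 ≤ C') → ∫⁻ x, ‖f x‖ₑ ^ 2 < ⊤ := by
    intro f C' h
    refine lt_of_le_of_lt ((le_of_eq (lintegral_congr fun x => ?_)).trans h) ENNReal.coe_lt_top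
    rw [← ofReal_norm, ← ofReal_norm, norm_iteratedFDeriv_zero]
  intro t ht hAfin
  have htI : t ∈ Icc 0 T := Ioo_subset_Icc_self ht
  -- the charge is finite
  have hfin : ∫⁻ x in {x | l < ‖u t x‖}, ENNReal.ofReal (m t x) ^ r < ⊤ := by
    by_contra hinf
    have htop : ∫⁻ x in {x | l < ‖u t x‖}, ENNReal.ofReal (m t x) ^ r = ⊤ := top_le_iff.1 (not_lt.1 hinf)
    apply hAfin
    rw [htop, ENNReal.top_rpow_of_pos (div_pos two_pos (by linarith))]
  have hmom : ∀ x, W t x + FluidPDE.convect (u t) (u t) x = ν • (Δ (u t)) x - gradient (p t) x := by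
    intro x
    have h := hsol.momentum t htI x
    simpa [hW] using h
  have hsl := truncatedLedger_slice hν (hsol.contDiff_velocity htI)
    ((hWsm.contDiff_slice htI).of_le (by norm_cast))
    ((hsol.contDiff_pressure htI).of_le (by norm_cast)) hmom (hsol.divFree t htI)
    (fun x => hB₀ t htI x) (fun x => hK₀ t htI x)
    ((hC₁ t htI).trans_lt ENNReal.coe_lt_top) ((hD₂ t htI).trans_lt ENNReal.coe_lt_top)
    ((hD₃ t htI).trans_lt ENNReal.coe_lt_top)
    (hzero (hE₀ t htI)) ((hE₁ t htI).trans_lt ENNReal.coe_lt_top)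
    (hzero' (hP₀ t htI)) ((hP₁ t htI).trans_lt ENNReal.coe_lt_top)
    hl hχ hχ01 hχ1 hχd0 hχ0 hD0 hχD (hm0 t) (hdir t ht) hr hfin
  -- abbreviations (abstracted in `hsl` and in the goal alike)
  set KS : ℝ := ((SNormLESNormFDerivOfEqConst (EuclideanSpace ℝ (Fin 3))
    (volume : Measure (EuclideanSpace ℝ (Fin 3))) 2 : ℝ)) with hKS
  set a : ℝ := 2 * (1 - (1 - 3 / (2 * r))) with ha
  set e : ℝ := 1 / (1 - 3 / (2 * r)) with he
  set c : ℝ := D * ‖curlCLM‖ ^ 2 + 1 with hc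
  have hKS0 : 0 ≤ KS := by rw [hKS]; exact NNReal.coe_nonneg _
  have hc0 : 0 ≤ c := by rw [hc]; positivity
  -- `N^e = A.toReal`, `N = ‖m 1_F‖_r`, and `(2 (c N) K_S^a)^e = (2 c K_S^a)^e N^e`
  set N : ℝ := ((∫⁻ x in {x | l < ‖u t x‖}, ENNReal.ofReal (m t x) ^ r) ^ (1 / r)).toReal with hN
  have hN0 : 0 ≤ N := ENNReal.toReal_nonneg
  have hNA : N ^ e = ((∫⁻ x in {x | l < ‖u t x‖}, ENNReal.ofReal (m t x) ^ r) ^ (2 / (2 * r - 3))).toReal := by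
    rw [hN, he, ENNReal.toReal_rpow, ← ENNReal.rpow_mul, hexp]
  have hsplit : (2 * (c * N) * KS ^ a) ^ e = (2 * c * KS ^ a) ^ e * N ^ e := by
    rw [show 2 * (c * N) * KS ^ a = (2 * c * KS ^ a) * N by ring, Real.mul_rpow (by positivity) hN0]
  rw [hsplit, hNA] at hsl
  refine hsl.trans (le_of_eq ?_)
  ring

/-- **Regularity from a stream-directional strain squeeze on the fast class.** For `ν, T > 0` and a
classical solution `(u, p)` of the unforced Navier–Stokes system on `ℝ³ × [0, T)` which is
Leray–Hopf from its rapidly decaying datum, a level `l > 0`, an exponent `r > 3/2` and a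
nonnegative `m` with `‖S(t,x) u(t,x)‖ ≤ m(t,x) ‖u(t,x)‖` at every fast point `l < ‖u(t,x)‖`,
`0 < t < T` (`S = ½(∇u + ∇uᵀ)`), and `∫₀ᵀ (∫_{l<‖u(t)‖} m(t)^r)^{2/(2r−3)} dt < ∞`: `u` extends as a
classical solution past `T`. NO slow-class hypothesis (module docstring). [cite: Miller2019, Thm 1.1] -/
theorem hasSmoothExtensionPast_of_streamStrainSqueeze {ν T : ℝ} (hν : 0 < ν) (hT : 0 < T)
    {u : ℝ → EuclideanSpace ℝ (Fin 3) → EuclideanSpace ℝ (Fin 3)}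
    {p : ℝ → EuclideanSpace ℝ (Fin 3) → ℝ} (hcl : IsClassicalNSSolutionOn (Set.Ico 0 T) ν 0 u p)
    (hLH : IsLerayHopfOn T ν 0 (u 0) u) (hdec : HasRapidSpatialDecay (u 0))
    {l : ℝ} (hl : 0 < l) {r : ℝ} (hr : 3 / 2 < r)
    {m : ℝ → EuclideanSpace ℝ (Fin 3) → ℝ} (hm0 : ∀ t x, 0 ≤ m t x)
    (hdir : ∀ t ∈ Ioo 0 T, ∀ x, l < ‖u t x‖ →
      ‖((1 / 2 : ℝ) • (fderiv ℝ (u t) x + ContinuousLinearMap.adjoint (fderiv ℝ (u t) x))) (u t x)‖ ≤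
        m t x * ‖u t x‖)
    (hΛ : ∫⁻ t in Ioo 0 T, (∫⁻ x in {x | l < ‖u t x‖}, ENNReal.ofReal (m t x) ^ r) ^ (2 / (2 * r - 3)) < ⊤) :
    HasSmoothExtensionPast ν 0 u T := by
  -- the cut-off of the squared speed
  obtain ⟨χ, D, hD0, hχ, hχ01, hχ1, hχd0, hχ0, hχD⟩ := exists_speed_cutoff hl
  -- the datum
  have h0I : (0 : ℝ) ∈ Ico 0 T := ⟨le_rfl, hT⟩
  have hsm : ContDiff ℝ ∞ (u 0) := hcl.contDiff_velocity h0I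
  have hdiv0 : VectorCalculus.IsDivFree (u 0) := hcl.divFree 0 h0I
  have hH : ∀ n : ℕ, ∫⁻ x, ‖iteratedFDeriv ℝ n (u 0) x‖ₑ ^ 2 < ⊤ := fun n =>
    hdec.lintegral_enorm_iteratedFDeriv_sq_lt_top n
  -- the constants of the ledger
  set Cl : ℝ := 108 * (‖curlCLM‖ ^ 2 + 1) * ‖curlCLM‖ ^ 2 * l ^ 2 / ν with hCl
  set κ : ℝ := (1 - 3 / (2 * r)) * (2 * (1 - (1 - 3 / (2 * r)))) ^ ((1 - (1 - 3 / (2 * r))) / (1 - 3 / (2 * r))) *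
      ν ^ (-((1 - (1 - 3 / (2 * r))) / (1 - 3 / (2 * r)))) *
      (2 * (D * ‖curlCLM‖ ^ 2 + 1) *
        ((SNormLESNormFDerivOfEqConst (EuclideanSpace ℝ (Fin 3))
          (volume : Measure (EuclideanSpace ℝ (Fin 3))) 2 : ℝ) ^ (2 * (1 - (1 - 3 / (2 * r)))))) ^
        (1 / (1 - 3 / (2 * r))) with hκ
  have hr0 : 0 < r := by linarith
  have hθ0 : 0 < 1 - 3 / (2 * r) := by
    rw [sub_pos, div_lt_one (by positivity)]; linarith
  have h1θ : 0 < 1 - (1 - 3 / (2 * r)) := by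
    have : (0 : ℝ) < 3 / (2 * r) := by positivity
    linarith
  have hCl0 : 0 ≤ Cl := by positivity
  have hκ0 : 0 ≤ κ := by positivity
  set A : ℝ → ℝ≥0∞ := fun t =>
    (∫⁻ x in {x | l < ‖u t x‖}, ENNReal.ofReal (m t x) ^ r) ^ (2 / (2 * r - 3)) with hA
  set Λ : ℝ≥0∞ := ∫⁻ t in Ioo 0 T, A t with hΛdef
  have hΛfin : Λ ≠ ⊤ := hΛ.ne
  set G0 : ℝ := ∫ x, frobeniusNormSq (fderiv ℝ (u 0) x) with hG0
  have hG00 : 0 ≤ G0 := integral_nonneg fun x => FluidPDE.frobeniusNormSq_nonneg _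
  set Estar : ℝ := (G0 + 1) * Real.exp (2 * Cl * T + (2 * κ + 1) * Λ.toReal) with hEstar
  have hEstar0 : 0 ≤ Estar := by positivity
  -- Tao persistence: `u` has bounded Sobolev norms on every closed sub-slab
  have hslabu : ∀ T' ∈ Ioo 0 T, HasBoundedSobolevNormsOn (Icc 0 T') u := by
    intro T' hT'
    have hsol' : IsClassicalNSSolutionOn (Icc 0 T') ν 0 u p :=
      hcl.mono (Icc_subset_Ico_right hT'.2) (uniqueDiffOn_Icc hT'.1)
    have hEn' : ∃ C' : ℝ≥0, ∀ t ∈ Icc 0 T', ∫⁻ x, ‖u t x‖ₑ ^ 2 ≤ C' :=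
      ⟨(2 * VectorCalculus.kineticEnergy (u 0)).toNNReal, fun t ht =>
        hLH.lintegral_enorm_sq_le hν.le ⟨ht.1, ht.2.trans hT'.2.le⟩⟩
    exact tao2011_hasBoundedSobolevNormsOn_holds hν hT'.1 hsol' hEn' hdec
  -- (a) every Tao-class solution from `u 0` on `[0, T'] ⊆ [0, T)` coincides with `u`
  have hcoin : ∀ T' ∈ Ioo 0 T, ∀ {v : ℝ → EuclideanSpace ℝ (Fin 3) → EuclideanSpace ℝ (Fin 3)}
      {q : ℝ → EuclideanSpace ℝ (Fin 3) → ℝ}, IsTaoSolutionOn T' ν (u 0) v q →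
      ∀ t ∈ Icc 0 T', u t = v t := by
    intro T' hT' v q hv t ht
    have hsol' : IsClassicalNSSolutionOn (Icc 0 T') ν 0 u p :=
      hcl.mono (Icc_subset_Ico_right hT'.2) (uniqueDiffOn_Icc hT'.1)
    exact MajdaBertozzi2002_uniquenessSobolev_holds hν.le hT'.1 hsol' hv.classical (hslabu T' hT')
      hv.sobolev hv.initial.symm t ht
  -- (b)+(c) the slab Grönwall for Tao-class solutions from `u 0`, uniformly in `T' < T`
  have hbound : ∀ T' ∈ Ioo 0 T, ∀ {v : ℝ → EuclideanSpace ℝ (Fin 3) → EuclideanSpace ℝ (Fin 3)}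
      {q : ℝ → EuclideanSpace ℝ (Fin 3) → ℝ}, IsTaoSolutionOn T' ν (u 0) v q →
      ∀ s ∈ Icc 0 T', ∫ x, frobeniusNormSq (fderiv ℝ (v s) x) ≤ Estar := by
    intro T' hT' v q hv s hs
    have huv : ∀ t ∈ Icc 0 T', u t = v t := hcoin T' hT' hv
    -- transfer of the directional majorant and of the charge
    have hdirv : ∀ t ∈ Ioo 0 T', ∀ x, l < ‖v t x‖ →
        ‖((1 / 2 : ℝ) • (fderiv ℝ (v t) x + ContinuousLinearMap.adjoint (fderiv ℝ (v t) x))) (v t x)‖ ≤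
          m t x * ‖v t x‖ := by
      intro t ht x hx
      rw [← huv t ⟨ht.1.le, ht.2.le⟩] at hx ⊢
      exact hdir t ⟨ht.1, ht.2.trans hT'.2⟩ x hx
    have hAeq : ∀ t ∈ Ioo 0 T',
        (∫⁻ x in {x | l < ‖v t x‖}, ENNReal.ofReal (m t x) ^ r) ^ (2 / (2 * r - 3)) = A t := by
      intro t ht
      rw [hA]; simp only
      rw [← huv t ⟨ht.1.le, ht.2.le⟩]
    have hΛv_le : ∫⁻ t in Ioo 0 T', A t ≤ Λ := lintegral_mono_set (Ioo_subset_Ioo le_rfl hT'.2.le)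
    have hΛv : ∫⁻ t in Ioo 0 T', A t ≠ ⊤ := ne_top_of_le_ne_top hΛfin hΛv_le
    -- the ledger at interior times of `[0, T']`
    have hled : ∀ t ∈ Ioo 0 T', A t ≠ ⊤ →
        ∫ x, ∑ i, ⟪fderiv ℝ (v t) x (EuclideanSpace.basisFun (Fin 3) ℝ i),
            fderiv ℝ (FluidPDE.timeDerivWithin (Icc 0 T') v t) x (EuclideanSpace.basisFun (Fin 3) ℝ i)⟫ ≤
          (Cl + κ * (A t).toReal) * ∫ x, frobeniusNormSq (fderiv ℝ (v t) x) := by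
      intro t ht hAt
      have hAt' : (∫⁻ x in {x | l < ‖v t x‖}, ENNReal.ofReal (m t x) ^ r) ^ (2 / (2 * r - 3)) ≠ ⊤ := by
        rw [hAeq t ht]; exact hAt
      have h := slab_ledger hν hT'.1 hv.classical hv.sobolev hv.sobolev_dt hv.sobolev_p hl hχ hχ01 hχ1
        hχd0 hχ0 hD0 hχD hr hm0 hdirv t ht hAt'
      rw [hAeq t ht] at h
      exact h
    -- the slab Grönwall for `(v, q)` on `[0, T']`
    have hslab := enstrophy_gronwall_of_ledger hT'.1 hv.classical hv.sobolev hv.sobolev_dt hCl0 hκ0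
      hΛv hled s hs
    have hv0 : v 0 = u 0 := hv.initial
    rw [hv0] at hslab
    refine hslab.trans ?_
    rw [hEstar]
    refine mul_le_mul_of_nonneg_left (Real.exp_le_exp.2 ?_) (by positivity)
    have h1 : 2 * Cl * T' ≤ 2 * Cl * T := by
      have := hT'.2.le; nlinarith [hCl0]
    have h2 : (2 * κ + 1) * (∫⁻ t in Ioo 0 T', A t).toReal ≤ (2 * κ + 1) * Λ.toReal :=
      mul_le_mul_of_nonneg_left (ENNReal.toReal_mono hΛfin hΛv_le) (by positivity)
    linarith
  -- (d) the a-priori bound in the form the continuation method consumes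
  have hapriori : ∀ ⦃T' : ℝ⦄, 0 < T' → ∀ T₁ ∈ Ioo 0 T, T' ≤ T₁ →
      ∀ ⦃v : ℝ → EuclideanSpace ℝ (Fin 3) → EuclideanSpace ℝ (Fin 3)⦄
        ⦃q : ℝ → EuclideanSpace ℝ (Fin 3) → ℝ⦄, IsTaoSolutionOn T' ν (u 0) v q →
        ∀ t ∈ Icc 0 T', ∫⁻ x, ‖iteratedFDeriv ℝ 1 (v t) x‖ₑ ^ 2 ≤ ENNReal.ofReal Estar := by
    intro T' hT'0 T₁ hT₁ hT'T₁ v q hv t ht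
    have hT' : T' ∈ Ioo 0 T := ⟨hT'0, hT'T₁.trans_lt hT₁.2⟩
    have hG := hbound T' hT' hv t ht
    have hcd : ContDiff ℝ ∞ (v t) := hv.classical.contDiff_velocity ht
    obtain ⟨C₁, hC₁⟩ := hv.sobolev 1
    have hfin : ∫⁻ x, ENNReal.ofReal (frobeniusNormSq (fderiv ℝ (v t) x)) < ⊤ := by
      calc ∫⁻ x, ENNReal.ofReal (frobeniusNormSq (fderiv ℝ (v t) x))
          ≤ ∫⁻ x, 3 * ‖iteratedFDeriv ℝ 1 (v t) x‖ₑ ^ 2 := lintegral_mono fun x => by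
            rw [← ofReal_norm, norm_iteratedFDeriv_one, ofReal_norm]
            exact ofReal_frobeniusNormSq_le_three_mul_enorm_sq _
        _ = 3 * ∫⁻ x, ‖iteratedFDeriv ℝ 1 (v t) x‖ₑ ^ 2 := lintegral_const_mul' _ _ (by norm_num)
        _ < ⊤ := ENNReal.mul_lt_top (by norm_num) ((hC₁ t ht).trans_lt ENNReal.coe_lt_top)
    have ifrob : Integrable (fun x => frobeniusNormSq (fderiv ℝ (v t) x)) volume :=
      integrable_of_continuous_of_nonneg (FluidPDE.continuous_frobeniusNormSq_fderiv hcd (by simp))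
        (fun x => FluidPDE.frobeniusNormSq_nonneg _) hfin
    calc ∫⁻ x, ‖iteratedFDeriv ℝ 1 (v t) x‖ₑ ^ 2 = ∫⁻ x, ‖fderiv ℝ (v t) x‖ₑ ^ 2 :=
          lintegral_congr fun x => by rw [← ofReal_norm, norm_iteratedFDeriv_one, ofReal_norm]
      _ ≤ ∫⁻ x, ENNReal.ofReal (frobeniusNormSq (fderiv ℝ (v t) x)) :=
          lintegral_mono fun x => enorm_sq_fderiv_le_ofReal_frobeniusNormSq _
      _ = ENNReal.ofReal (∫ x, frobeniusNormSq (fderiv ℝ (v t) x)) :=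
          (ofReal_integral_eq_lintegral_ofReal ifrob
            (Eventually.of_forall fun x => FluidPDE.frobeniusNormSq_nonneg _)).symm
      _ ≤ ENNReal.ofReal Estar := ENNReal.ofReal_le_ofReal hG
  -- (e) enstrophy bound on `[0, T)`: for `t < T` build a Tao solution on `[0, (t+T)/2]` and identify
  have hE : ∃ E : ℝ, ∀ t ∈ Set.Ico 0 T, ∫⁻ x, ‖fderiv ℝ (u t) x‖ₑ ^ 2 ≤ ENNReal.ofReal E := by
    refine ⟨Estar, fun t ht => ?_⟩
    set T₁ : ℝ := (t + T) / 2 with hT₁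
    have hT₁I : T₁ ∈ Ioo 0 T := ⟨by rw [hT₁]; linarith [ht.1, ht.2], by rw [hT₁]; linarith [ht.2]⟩
    have htT₁ : t ∈ Icc 0 T₁ := ⟨ht.1, by rw [hT₁]; linarith [ht.2]⟩
    obtain ⟨v, q, hv⟩ := exists_isTaoSolutionOn_of_enstrophy_apriori hν hsm hdiv0 hH hT₁I.1 hEstar0
      (fun T' hT'0 hT'le v q hv => hapriori hT'0 T₁ hT₁I hT'le hv)
    have huv : u t = v t := hcoin T₁ hT₁I hv t htT₁
    have h := hapriori hT₁I.1 T₁ hT₁I le_rfl hv t htT₁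
    rw [← huv] at h
    calc ∫⁻ x, ‖fderiv ℝ (u t) x‖ₑ ^ 2 = ∫⁻ x, ‖iteratedFDeriv ℝ 1 (u t) x‖ₑ ^ 2 :=
          lintegral_congr fun x => by rw [← ofReal_norm, ← norm_iteratedFDeriv_one, ofReal_norm]
      _ ≤ ENNReal.ofReal Estar := h
  -- (f) `H¹` continuation
  exact Birth.stub_enstrophyContinuation ν T hν hT u p hcl hLH hdec hE

end Summit.NavierStokesRegularity.NavierStokesRegularity.Theorems.FastClassSqueeze.StreamStrain

end
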